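import Literature.MathematicalPhysics.QuantumFieldTheory.Balaban1983to89.Node00.DomainsRefinement

/-!
# NODE 00 — the REFINEMENT ORDER on nested domain families and their LEVELWISE MEET: [B11] (150)'s «more restrictive functional conditions» as an object
# (`Ω′_j := □_j ∩ Ω_j`), with `ker Q_{D′} ⊆ ker Q_D` and `N(Q′_{D′}) ⊆ N(Q′_D)` for `D′ ≤ D` from lit-balaban's Lemma S ∕ Lemma V by name

Cell `pub-ymgap` (HUMAN RULINGS D-0062 ∕ D-0088), seat `pub-ymgap-dag-n07-e` g20 (R141 (C) row s3 lineage; DAG node N07 = [B11]; lane owner, declarer of `Node00.cubeDomains`),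
2026-08-28.  `--kind definition --supports stmt-QuantumFields-20541` (K0⁷; count-neutral).  Answers k0-s1-w3 g5's question «Q-CUBE-TOP» (cell bus 2026-08-28 07:03Z) and
dag-n07-w4 g3's LOCATED-BOUNDARY-DATUM (07:07Z): which nested family the per-cube variational problem of [B11] Sect. F carries at a datum whose collared top cube is NOT
inside the record's `Ω_k`.

THE PRINT.  [B11] = T. Bałaban, *The variational problem and background fields in renormalization group method for lattice gauge theories*, Commun. Math. Phys. **102** (1985)
277–309 `[Balaban1985Variational]`, p. 301: (147) *«V′ is defined on (□_k ∩ Λ_{k−1}) ∪ (□_k ∩ Λ_k) = □′_k^{(k−1)} ∪ □″_k^{(k)}»*, (148) *«Λ′_{k−1} = (□_{k−1}^{(k−1)} ∖ □_k^{(k−1)}) ∪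
□′_k^{(k−1)}, Λ′_k = □″_k^{(k)}»*, (150) *«U′_k ∈ 𝔄_k({Ω′_j}, ε₀) ∩ 𝔅_k(ℭ_k, V″) ∩ Ax_k(ℭ_k, 1), where Ω′_j = □_j, j = 0, …, k−1, Ω′_k = □″_k … The configuration U′_k is a
minimum of the functional (5) in the space (6) with V″ instead of V, hence it is a minimum of this functional in the space (150), BECAUSE THIS SPACE IS DEFINED BY MORE
RESTRICTIVE FUNCTIONAL CONDITIONS and a sufficiently small neighborhood of U′_k in (150) is contained in (6)»*.  [B6] = *Propagators and renormalization transformations for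
lattice gauge theories. II*, CMP **96** (1984) `[Balaban1984PropagatorsII]`, (2.1)–(2.3) p. 224 (nested families `Ω_j`, `Λ_j = Ω_j ∖ Ω_{j+1}`, bonds by `st`), (2.6)–(2.7) (the
constraints `Q_jA = B on Λ_j`, the gauge class `Q′_jλ = 0 on Λ_j`), (2.10), (2.20).

WHY.  The per-cube family of record `Node00.cubeDomains P a M ρ i` (`TorusCoverCubeDomains` §2) puts level `i` on the WHOLE collared top cube `□_i`; print's (150) puts level `k`
only on `□″_k = □_k ∩ Ω_k` and keeps the record's FINER level on `□′_k = □_k ∖ Ω_k`.  For a datum deep inside `Ω_k` the two agree; at a BOUNDARY datum (they exist and are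
served by the S6 head — dag-n07-w4 LOCATED-BOUNDARY-DATUM) the constraints of `cubeDomains` on `□′_k` are COARSER than the record's, so a tangent vector of the per-cube
fibre supported there moves the record's level-(k−1) averages and the record's criticality does not transfer (k0-s1-w3's witness).  Print's remedy is (150) = «more
restrictive functional conditions», i.e. a family whose regions are levelwise SMALLER: `Ω′_j = □_j ∩ Ω_j` for all `j` (print writes `□_j` for `j < k`, where `□_j ⊂ Ω_j` by
the collar arithmetic of (144)).  INTENT-44 types the two generic facts behind that sentence over lit-balaban's V1 carriers: (1) (file A `Node00/DomainsRefinement`) the REFINEMENT ORDER `D′ ≤ D :⇔ ∀ j,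
Ω′_j^{(j)} ⊆ Ω_j^{(j)}` makes every constraint of `D` a consequence of the constraints of `D′` — `ker Q_{D′} ⊆ ker Q_D` (Lemma V, `bondAvgIter_eq_zero_of_constr_zero`) and
`N(Q′_{D′}) ⊆ N(Q′_D)` (Lemma S, `siteAvgIter_eq_zero_of_inGauge`), because a `D`-indexed block∕bond has end-points not inside `Ω_{j+1} ⊇ Ω′_{j+1}`; (2) the LEVELWISE MEET
`D₁ ⊓ D₂` (`Ω_j := Ω_j^{D₁} ∩ Ω_j^{D₂}`) is again a nested family, below both, and the greatest such — so `cubeDomains ⊓ D_rec ≤ D_rec` is print's (150) family with the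
kernel inclusion the S4 criticality transfer (`h128` ∕ `critical128`) asks for.  Admissibility (2.1)–(2.2) of the meet (`Adm22`, a Summits-side predicate) and the record
instance are the Summits sequel; nothing of them is claimed here.

WHAT IS PROVED (sorry-free; ONE definition `domainsMeet`; axioms standard; generic `P : Params`, every pair of V1 families; the refinement theorems `not_deep_of_domainsLe`,
`inGauge_of_domainsLe`, `constrZero_of_domainsLe`, `QE_eq_zero_of_domainsLe`, … are file A `Node00/DomainsRefinement`, hypothesis form `∀ j, D′.Om j ⊆ D.Om j`).
* ★ `domainsMeet D₁ D₂ : Domains P` (`k := min D₁.k D₂.k`, `Om j := D₁.Om j ∩ D₂.Om j`), `domainsMeet_k`, `domainsMeet_Om`, `mem_domainsMeet_Om`, ★ `domainsMeet_le_left` ∕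
  `domainsMeet_le_right`, ★ `domainsLe_meet` (greatest lower bound), `deep_domainsMeet_iff`, and the corollaries of record ★★ `constrZero_left_of_meet` ∕ `constrZero_right_of_meet`,
  `inGauge_left_of_meet` ∕ `inGauge_right_of_meet`, `QE_left_eq_zero_of_meet` ∕ `QE_right_eq_zero_of_meet`.
HONEST SCOPE.  Set∕lattice bookkeeping over lit-balaban's V1 files BY NAME (Lemma S, Lemma V, `mem_ker_QpE_iff`, `QE_eq_zero_iff`); the constraint letters are the STRAIGHT
averages `Q_j = bondAvgIter j` ∕ `Q′_j = siteAvgIter j` of V1 (the record's linearised (0.4) average `Q_j(1)` differs by the comb pure gauge — k0-s1-w1's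
`…K0Stub1FlatAveragingDictionary`; the inclusion for those letters is the same argument on `dIterL`, not typed here); nothing about admissibility (2.1)–(2.2), cube datums, or
the record's `s.Ω` (Summits sequel); nothing of [B11]'s analysis asserted; `stub_prop8StepCoP13` ∕ K0⁷ NOT closed; N07 NOT discharged; counts unmoved (28∕28 · 5∕27); one finite
𝕋⁴ programme at fixed ε — the route closes the conditional finite-𝕋⁴ rung `BalabanLadder.UV` only; nothing continuum ∕ ℝ⁴ ∕ OS ∕ mass gap ∕ Clay.  No `sorry`, no `instance`,
no `notation`.

References: [B11] (144)–(150) pp. 300–301, (156)–(158) p. 302; [B6] (2.1)–(2.3), (2.6)–(2.7) p. 224, (2.10) p. 225, (2.20) p. 226.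
-/

set_option autoImplicit false

namespace Literature.MathematicalPhysics.QuantumFieldTheory.Balaban1983to89.Node00

open LatticeFieldCalculus (siteAvgIter bondAvgIter)
open B6SectADomainsV1 (Domains)
open B6SectAOperatorsV1 (QE QpE ScalarSpace mem_ker_QpE_iff QE_eq_zero_iff)
open BalabanImbrieJaffe1984to88.BIJ85AxialPropagator411 (BondSpace)

variable {P : Params}

/-! ## §3  The levelwise meet `D₁ ⊓ D₂`: `Ω_j := Ω_j^{D₁} ∩ Ω_j^{D₂}` — print's `Ω′_j = □_j ∩ Ω_j` -/

/-- ★ **The levelwise meet of two nested families** ((150): `Ω′_j := □_j ∩ Ω_j`, `j = 0, …, k`): regions intersected level by level, number of levels the minimum; again nested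
(`Ω₀ = T`, empty above the top, `B^j`-blocks of `Ω′_{j+1}` inside `Ω′_j`). [cite: Balaban1985Variational, (150) p.301; Balaban1984PropagatorsII, (2.1) p.224] -/
def domainsMeet (D₁ D₂ : Domains P) : Domains P where
  k := min D₁.k D₂.k
  hk := (min_le_left _ _).trans D₁.hk
  Om j := D₁.Om j ∩ D₂.Om j
  Om_zero := by rw [D₁.Om_zero, D₂.Om_zero, Finset.inter_self]
  Om_eq_empty j hj := by
    rcases min_lt_iff.mp hj with h | h
    · rw [D₁.Om_eq_empty h, Finset.empty_inter]
    · rw [D₂.Om_eq_empty h, Finset.inter_empty]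
  nested j y hy := by
    rw [Finset.mem_inter] at hy ⊢
    exact ⟨D₁.nested y hy.1, D₂.nested y hy.2⟩

/-- The meet has `min` levels. [cite: Balaban1984PropagatorsII, (2.1) p.224 (bookkeeping)] -/
theorem domainsMeet_k (D₁ D₂ : Domains P) : (domainsMeet D₁ D₂).k = min D₁.k D₂.k := rfl

/-- The meet's regions. [cite: Balaban1985Variational, (150) p.301 (bookkeeping)] -/
theorem domainsMeet_Om (D₁ D₂ : Domains P) (j : ℕ) : (domainsMeet D₁ D₂).Om j = D₁.Om j ∩ D₂.Om j := rfl

/-- Membership in the meet's regions. [cite: Balaban1985Variational, (150) p.301 (bookkeeping)] -/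
theorem mem_domainsMeet_Om (D₁ D₂ : Domains P) (j : ℕ) (y : Site P j) : y ∈ (domainsMeet D₁ D₂).Om j ↔ y ∈ D₁.Om j ∧ y ∈ D₂.Om j := by
  rw [domainsMeet_Om, Finset.mem_inter]

/-- Deepness for the meet is deepness for both. [cite: Balaban1984PropagatorsII, (2.3) p.224 (bookkeeping)] -/
theorem deep_domainsMeet_iff (D₁ D₂ : Domains P) (j : ℕ) (y : Site P j) : (domainsMeet D₁ D₂).Deep j y ↔ D₁.Deep j y ∧ D₂.Deep j y := by
  show blockOf y ∈ (domainsMeet D₁ D₂).Om (j + 1) ↔ blockOf y ∈ D₁.Om (j + 1) ∧ blockOf y ∈ D₂.Om (j + 1)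
  rw [mem_domainsMeet_Om]

/-- ★ The meet is below the first family. [cite: Balaban1985Variational, (150) p.301] -/
theorem domainsMeet_le_left (D₁ D₂ : Domains P) : ∀ j : ℕ, (domainsMeet D₁ D₂).Om j ⊆ D₁.Om j := fun _ => Finset.inter_subset_left

/-- ★ The meet is below the second family. [cite: Balaban1985Variational, (150) p.301] -/
theorem domainsMeet_le_right (D₁ D₂ : Domains P) : ∀ j : ℕ, (domainsMeet D₁ D₂).Om j ⊆ D₂.Om j := fun _ => Finset.inter_subset_right

/-- ★ The meet is the GREATEST family below both (greatest lower bound in the refinement order). [cite: Balaban1985Variational, (150) p.301 (bookkeeping)] -/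
theorem domainsLe_meet {D' D₁ D₂ : Domains P} (h₁ : ∀ j : ℕ, D'.Om j ⊆ D₁.Om j) (h₂ : ∀ j : ℕ, D'.Om j ⊆ D₂.Om j) :
    ∀ j : ℕ, D'.Om j ⊆ (domainsMeet D₁ D₂).Om j :=
  fun j => Finset.subset_inter (h₁ j) (h₂ j)

/-- The meet is symmetric at the level of regions. [cite: Balaban1985Variational, (150) p.301 (bookkeeping)] -/
theorem domainsMeet_Om_comm (D₁ D₂ : Domains P) (j : ℕ) : (domainsMeet D₁ D₂).Om j = (domainsMeet D₂ D₁).Om j := by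
  rw [domainsMeet_Om, domainsMeet_Om, Finset.inter_comm]

/-- ★★ **(150) for the meet, constraints of the FIRST factor**: straight averages of `A` vanishing on the meet's indexed bonds vanish on every `D₁`-indexed bond —
`ker Q_{D₁ ⊓ D₂} ⊆ ker Q_{D₁}`. [cite: Balaban1985Variational, (150) p.301; Balaban1984PropagatorsII, (2.20) p.226] -/
theorem constrZero_left_of_meet (D₁ D₂ : Domains P) {A : VecField P 0 ℝ}
    (hA : ∀ (j : ℕ) (b : PBond P j), (domainsMeet D₁ D₂).LamBond j b → bondAvgIter j A b = 0) :
    ∀ (j : ℕ) (b : PBond P j), D₁.LamBond j b → bondAvgIter j A b = 0 :=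
  constrZero_of_domainsLe (domainsMeet_le_left D₁ D₂) hA

/-- ★★ **(150) for the meet, constraints of the SECOND factor** (at the record: `cubeDomains ⊓ D_rec` refines the RECORD's family, so a tangent vector of the per-cube fibre is
tangent to the record's fibre — the inclusion the criticality transfer needs): `ker Q_{D₁ ⊓ D₂} ⊆ ker Q_{D₂}`. [cite: Balaban1985Variational, (150) p.301; Balaban1984PropagatorsII, (2.20) p.226] -/
theorem constrZero_right_of_meet (D₁ D₂ : Domains P) {A : VecField P 0 ℝ}
    (hA : ∀ (j : ℕ) (b : PBond P j), (domainsMeet D₁ D₂).LamBond j b → bondAvgIter j A b = 0) :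
    ∀ (j : ℕ) (b : PBond P j), D₂.LamBond j b → bondAvgIter j A b = 0 :=
  constrZero_of_domainsLe (domainsMeet_le_right D₁ D₂) hA

/-- Gauge classes: `N(Q′_{D₁⊓D₂}) ⊆ N(Q′_{D₁})`. [cite: Balaban1984PropagatorsII, (2.7) p.224, (2.10) p.225] -/
theorem inGauge_left_of_meet (D₁ D₂ : Domains P) {lam : SiteField P 0 ℝ} (h : (domainsMeet D₁ D₂).InGauge lam) : D₁.InGauge lam :=
  inGauge_of_domainsLe (domainsMeet_le_left D₁ D₂) h

/-- Gauge classes: `N(Q′_{D₁⊓D₂}) ⊆ N(Q′_{D₂})`. [cite: Balaban1984PropagatorsII, (2.7) p.224, (2.10) p.225] -/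
theorem inGauge_right_of_meet (D₁ D₂ : Domains P) {lam : SiteField P 0 ℝ} (h : (domainsMeet D₁ D₂).InGauge lam) : D₂.InGauge lam :=
  inGauge_of_domainsLe (domainsMeet_le_right D₁ D₂) h

/-- Operator form: `Q_{D₁⊓D₂}x = 0 ⇒ Q_{D₁}x = 0`. [cite: Balaban1984PropagatorsII, (2.20) p.226] -/
theorem QE_left_eq_zero_of_meet (D₁ D₂ : Domains P) {x : BondSpace P} (hx : QE (domainsMeet D₁ D₂) x = 0) : QE D₁ x = 0 :=
  QE_eq_zero_of_domainsLe (domainsMeet_le_left D₁ D₂) hx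

/-- Operator form: `Q_{D₁⊓D₂}x = 0 ⇒ Q_{D₂}x = 0`. [cite: Balaban1984PropagatorsII, (2.20) p.226] -/
theorem QE_right_eq_zero_of_meet (D₁ D₂ : Domains P) {x : BondSpace P} (hx : QE (domainsMeet D₁ D₂) x = 0) : QE D₂ x = 0 :=
  QE_eq_zero_of_domainsLe (domainsMeet_le_right D₁ D₂) hx

/-- When the first family is already below the second, the meet has the first family's regions (interior datums: `□_j ⊂ Ω_j` for all `j` ⇒ `cubeDomains ⊓ D_rec` has the regions
of `cubeDomains`). [cite: Balaban1985Variational, (150) p.301 (bookkeeping)] -/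
theorem domainsMeet_Om_of_le {D₁ D₂ : Domains P} (h : ∀ j : ℕ, D₁.Om j ⊆ D₂.Om j) (j : ℕ) : (domainsMeet D₁ D₂).Om j = D₁.Om j := by
  rw [domainsMeet_Om]
  exact Finset.inter_eq_left.mpr (h j)

end Literature.MathematicalPhysics.QuantumFieldTheory.Balaban1983to89.Node00
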